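import Mathlib
import HarnessLib
import Summits.Ventures.LatticeQCDFlow.Scaling.AutoregressiveGaugePlaquetteReads
import Summits.Ventures.LatticeQCDFlow.Scaling.Wilson2DU1DominoDensity
import Summits.Ventures.LatticeQCDFlow.Scaling.U1ConvolutionFirstPowerStrict

/-!
# LatticeQCDFlow / Scaling — two dimensions, `U(1)`: THE LINK CLOSING A PLAQUETTE READS THE NEXT
# COLLINEAR LINK — A LINK IT SHARES NO PLAQUETTE WITH — THROUGH THE INTEGRATED SHARED LINK

HONEST FRAMING: exact (Metropolis-corrected) sampling algorithms for lattice gauge theory;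
figures of merit are autocorrelation/cost numbers at stated couplings and volumes; no
continuum-physics claim.

Venture `LatticeQCDFlow` (cell pub-lqcd), topic `Scaling`, FANOUT row 30 (lean-1, GEN-18) — OUR WORK on
THEORY-2.md §4 row C5, gauge case: the gauge analogue of "faithful THROUGH the integrated block".  Setting:
`(ℤ/L)²`, `L ≥ 2`, `G = U(1)`, Wilson weight `F = e^{−β S_W}`, `β > 0`; the domino at `x` = plaquettes
`(x; 0, 1)` and `(x + e₀; 0, 1)` sharing the link `ℓ = (x + e₀, 1)`.  Integrate `ℓ` AND every link off the
domino: `s` = all links except the six boundary links `e₁ = (x, 0)` (the current link), `e₃ = (x + e₁, 0)`,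
`e₄ = (x, 1)`, `f₁ = (x + e₀, 0)`, `f₂ = (x + 2e₀, 1)`, `f₃ = (x + e₀ + e₁, 0)`; `N = A_s F` (partial Haar
marginal, `Exactness.coordAvg`), `M = A_{insert e₁ s} F`, exact conditional of `U_{e₁}` = `N/M`.

* §1 **`wilson2D_u1_dominoMarginal_reads_closingLink`** — THE ENGINE: `N` is not blind to `e₁`.  If it
  were, redrawing `e₁` (`Scaling/Wilson2DU1DominoDensity.integral_comp_dominoHolonomy_mul`) together
  with `A_s F` = conditional expectation (`integral_mul_coordAvg_eq`) would make the law of the domino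
  holonomy `hol_x·hol_{x+e₀}` HAAR — contradicting its density `(K_w w)(K_w^{L²−3} w)/Z`
  (`wilson2D_u1_setIntegral_dominoHolonomy_eq`), which is continuous and not a.e. constant
  (`Scaling/U1ConvolutionFirstPowerStrict`).
* §2 **`wilson2D_u1_closingLink_reads_collinearLink`** — there are two configurations differing ONLY at
  `f₁ = (x + e₀, 0)` on which `N/M` differs: THE CLOSING LINK READS THE NEXT COLLINEAR LINK, with which
  it shares the site `x + e₀` but NO PLAQUETTE (it lies outside the plaquette-neighbourhood
  `plaqNbhd e₁` that bounds the context when nothing is integrated, GEN-15).  Proof: gauge covariance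
  at the corner `x + e₀` — whose links outside `s` are exactly `e₁` (incoming) and `f₁` (outgoing), so
  `N(U_{e₁}g⁻¹, gU_{f₁}, …) = N(U)` (`coordAvg_pathHolonomy`), while `M` reads neither `e₁` nor the
  then-buried `f₁` (`coordAvg_update_of_buried`) — turns "`N/M` blind to `f₁`" into "`N/M` blind to
  `e₁`", i.e. `N` blind to `e₁`, against §1.  Corollary `wilson2D_u1_closingLink_reads_farPlaquette`:
  a fortiori `N/M` reads the far boundary `{f₁, f₂, f₃}` of the second plaquette.

READING (value-free, C5): for two-dimensional `U(1)` the exact autoregressive context of a link is NOT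
confined to the links it shares a plaquette with: once the shared link of two adjacent plaquettes is
integrated, the closing link of one plaquette reads the other plaquette's links — reach THROUGH the
integrated block, the gauge counterpart of `Scaling/AutoregressiveBlockFaithful`.  The same corner
argument walks further along the boundary (each boundary link individually; longer chains of integrated
plaquettes via the law `(K_w^{m−1} w)(K_w^{L²−1−m} w)/Z` of an `m`-plaquette strip) — not typed here.
NOT CLAIMED: non-abelian groups, `d ≥ 3`; which function of `U_{f₁}` is read beyond "not constant"; any
number of ours.  Elementary over the parents; no `def`; nothing is cited as a fact; no `sorry`.
-/

noncomputable section

namespace Summit.Ventures.LatticeQCDFlow.Theory2.Autoregressive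

open MeasureTheory Function Set
open Literature.MathematicalPhysics.QuantumFieldTheory Literature.MathematicalPhysics.QuantumLattice
open Summit.Ventures.LatticeQCDFlow.Exactness Summit.Ventures.LatticeQCDFlow.Theory2.HaarConv
open scoped ENNReal

variable {L : ℕ} [NeZero L]

/-! ## §1 The engine: the domino marginal reads the closing link -/

/-- **THE DOMINO MARGINAL READS THE CLOSING LINK** (2-d `U(1)`, `β > 0`, `L ≥ 2`): with `s` the links off
the boundary of the domino `(x; 0,1) ∪ (x+e₀; 0,1)` (the shared link `(x+e₀, 1)` is IN `s`), the partial
Haar marginal `N = A_s e^{−βS_W}` is not blind to `e₁ = (x, 0)`: `N(U[e₁ ↦ v]) ≠ N(U)` for some `U, v`.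
Otherwise the domino holonomy would be Haar-distributed under the Wilson weight, against its
non-constant continuous density `(K_w w)(K_w^{L²−3} w)/Z`. [ours] -/
theorem wilson2D_u1_dominoMarginal_reads_closingLink (hL : 2 ≤ L) {β : ℝ} (hβ : 0 < β) (x : Site 2 L) :
    ∃ (U : GaugeConfig 2 L Circle) (v : Circle),
      coordAvg (haarProbability Circle)
          (Finset.univ \ {(x, (0 : Fin 2)), (x.shift 1, (0 : Fin 2)), (x, (1 : Fin 2)),
            (x.shift 0, (0 : Fin 2)), ((x.shift 0).shift 0, (1 : Fin 2)), ((x.shift 0).shift 1, (0 : Fin 2))})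
          (fun V : GaugeConfig 2 L Circle => Real.exp (-β * wilsonAction u1Rep V)) (update U (x, (0 : Fin 2)) v) ≠
      coordAvg (haarProbability Circle)
          (Finset.univ \ {(x, (0 : Fin 2)), (x.shift 1, (0 : Fin 2)), (x, (1 : Fin 2)),
            (x.shift 0, (0 : Fin 2)), ((x.shift 0).shift 0, (1 : Fin 2)), ((x.shift 0).shift 1, (0 : Fin 2))})
          (fun V : GaugeConfig 2 L Circle => Real.exp (-β * wilsonAction u1Rep V)) U := by
  classical
  set μ := haarProbability Circle with hμ
  set s : Finset (Edge 2 L) := Finset.univ \ {(x, (0 : Fin 2)), (x.shift 1, (0 : Fin 2)), (x, (1 : Fin 2)),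
    (x.shift 0, (0 : Fin 2)), ((x.shift 0).shift 0, (1 : Fin 2)), ((x.shift 0).shift 1, (0 : Fin 2))} with hs
  set F : GaugeConfig 2 L Circle → ℝ := fun V => Real.exp (-β * wilsonAction u1Rep V) with hF
  set N := coordAvg μ s F with hN
  by_contra hcon
  push Not at hcon
  -- hcon : ∀ U v, N (update U (x, 0) v) = N U
  obtain ⟨hFm, hFb, hFlo⟩ := wilsonWeight_two_u1_props (L := L) β hβ.le
  have hF1 : ∀ V, F V ≤ 1 := fun V => (le_abs_self _).trans (hFb V)
  have hNb : ∀ U, Real.exp (-(2 * β * (L : ℝ) ^ 2)) ≤ N U ∧ N U ≤ 1 := fun U =>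
    coordAvg_mem_Icc μ s hFm hFlo hF1 U
  have hNpos : ∀ U, 0 < N U := fun U => lt_of_lt_of_le (Real.exp_pos _) (hNb U).1
  have hNabs : ∀ U, |N U| ≤ 1 := fun U => by rw [abs_of_pos (hNpos U)]; exact (hNb U).2
  -- the law of the domino holonomy would be Haar
  have hD := u1_dominoDensity_not_ae_const hβ (L ^ 2 - 3) (∫ V, F V ∂Measure.pi (fun _ : Edge 2 L => μ))
  apply hD
  have hwm : Measurable (u1W β) := measurable_u1W β
  have hK1le : ∀ g, haarConv (u1W β) (u1W β) g ≤ 1 := fun g => by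
    have h := iterate_apply_le_one hwm (u1W_le_one hβ.le) 1 g
    rwa [Function.iterate_one] at h
  have hKle : ∀ g, haarConv (u1W β) (u1W β) g * (haarConv (u1W β))^[L ^ 2 - 3] (u1W β) g ≤ 1 := fun g =>
    mul_le_one' (hK1le g) (iterate_apply_le_one hwm (u1W_le_one hβ.le) _ g)
  have hDm : Measurable fun g =>
      (haarConv (u1W β) (u1W β) g * (haarConv (u1W β))^[L ^ 2 - 3] (u1W β) g).toReal :=
    ((measurable_haarConv hwm hwm).mul (measurable_iterate hwm hwm _)).ennreal_toReal
  have hDi : Integrable (fun g =>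
      (haarConv (u1W β) (u1W β) g * (haarConv (u1W β))^[L ^ 2 - 3] (u1W β) g).toReal) μ :=
    Integrable.mono' (integrable_const 1) hDm.aestronglyMeasurable (ae_of_all _ fun g => by
      rw [Real.norm_eq_abs, abs_of_nonneg ENNReal.toReal_nonneg]
      exact ENNReal.toReal_le_of_le_ofReal zero_le_one (by simpa using hKle g))
  refine Integrable.ae_eq_of_forall_setIntegral_eq _ _ hDi (integrable_const _) fun A hA _ => ?_
  rw [setIntegral_const, ← wilson2D_u1_setIntegral_dominoHolonomy_eq β hL hβ.le x hA]
  -- the test function `1_A ∘ (hol_x · hol_{x+e₀})` is blind to `s` (a word in the six boundary links)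
  let φ : Circle → ℝ := A.indicator fun _ => 1
  have hφm : Measurable φ := measurable_const.indicator hA
  have hφb : ∀ g, |φ g| ≤ 1 := fun g => by
    simp only [φ, Set.indicator_apply]; split_ifs <;> simp
  have hhm : Measurable fun U : GaugeConfig 2 L Circle =>
      plaquetteHolonomy U x 0 1 * plaquetteHolonomy U (x.shift 0) 0 1 :=
    (measurable_plaquetteHolonomy x 0 1).mul (measurable_plaquetteHolonomy (x.shift 0) 0 1)
  have hn1 : ((x, (0 : Fin 2)) : Edge 2 L) ∉ s := by simp [hs]
  have hn3 : ((x.shift 1, (0 : Fin 2)) : Edge 2 L) ∉ s := by simp [hs]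
  have hn4 : ((x, (1 : Fin 2)) : Edge 2 L) ∉ s := by simp [hs]
  have hm1 : ((x.shift 0, (0 : Fin 2)) : Edge 2 L) ∉ s := by simp [hs]
  have hm2 : (((x.shift 0).shift 0, (1 : Fin 2)) : Edge 2 L) ∉ s := by simp [hs]
  have hm3 : (((x.shift 0).shift 1, (0 : Fin 2)) : Edge 2 L) ∉ s := by simp [hs]
  have hhol_s : ∀ U V : GaugeConfig 2 L Circle,
      plaquetteHolonomy (s.piecewise V U) x 0 1 * plaquetteHolonomy (s.piecewise V U) (x.shift 0) 0 1 =
        plaquetteHolonomy U x 0 1 * plaquetteHolonomy U (x.shift 0) 0 1 := by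
    intro U V
    rw [plaquetteHolonomy_mul_shift_zero, plaquetteHolonomy_mul_shift_zero]
    simp only [Finset.piecewise_eq_of_notMem _ _ _ hn1, Finset.piecewise_eq_of_notMem _ _ _ hn3,
      Finset.piecewise_eq_of_notMem _ _ _ hn4, Finset.piecewise_eq_of_notMem _ _ _ hm1,
      Finset.piecewise_eq_of_notMem _ _ _ hm2, Finset.piecewise_eq_of_notMem _ _ _ hm3]
  -- `∫ φ(hol)·F = ∫ φ(hol)·N` (conditional expectation)
  show ∫ U, φ (plaquetteHolonomy U x 0 1 * plaquetteHolonomy U (x.shift 0) 0 1) * F U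
      ∂(Measure.pi fun _ : Edge 2 L => μ) = _
  rw [integral_mul_coordAvg_eq μ s
    (Φ := fun U => φ (plaquetteHolonomy U x 0 1 * plaquetteHolonomy U (x.shift 0) 0 1)) hFm ⟨1, hFb⟩
    (hφm.comp hhm) ⟨1, fun U => hφb _⟩ (fun U V => by simp only [hhol_s])]
  -- redraw `e₁`: `∫ φ(hol U)·N U = (∫ φ dμ)·(∫ N) = (∫ φ dμ)·(∫ F)`
  show ∫ U, φ (plaquetteHolonomy U x 0 1 * plaquetteHolonomy U (x.shift 0) 0 1) * N U
      ∂(Measure.pi fun _ : Edge 2 L => μ) = _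
  rw [integral_comp_dominoHolonomy_mul hL x hφm hφb (measurable_coordAvg μ s hFm) hNabs hcon,
    integral_coordAvg_eq μ s hFm ⟨1, hFb⟩]
  have hφint : ∫ g, φ g ∂μ = μ.real A := by
    simp only [φ]
    rw [integral_indicator hA, setIntegral_const, smul_eq_mul, mul_one]
  rw [hφint, smul_eq_mul]

/-! ## §2 The closing link reads the next collinear link (and, a fortiori, the far plaquette) -/

/-- **THE LINK CLOSING A PLAQUETTE READS THE NEXT COLLINEAR LINK THROUGH THE INTEGRATED SHARED LINK**
(2-d `U(1)`, Wilson action, every `L ≥ 2`, `β > 0`).  With `s` the links off the boundary of the domino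
`(x; 0,1) ∪ (x+e₀; 0,1)`, `e₁ = (x, 0)`, `N = A_s e^{−βS_W}`, `M = A_{insert e₁ s} e^{−βS_W}`: there are
two configurations differing ONLY at `f₁ = (x + e₀, 0)` — a link sharing no plaquette with `e₁` — on
which the exact conditional `N/M` of `U_{e₁}` differs. [ours] -/
theorem wilson2D_u1_closingLink_reads_collinearLink (hL : 2 ≤ L) {β : ℝ} (hβ : 0 < β) (x : Site 2 L) :
    ∃ U U' : GaugeConfig 2 L Circle,
      (∀ e : Edge 2 L, e ≠ (x.shift 0, (0 : Fin 2)) → U e = U' e) ∧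
      coordAvg (haarProbability Circle)
          (Finset.univ \ {(x, (0 : Fin 2)), (x.shift 1, (0 : Fin 2)), (x, (1 : Fin 2)),
            (x.shift 0, (0 : Fin 2)), ((x.shift 0).shift 0, (1 : Fin 2)), ((x.shift 0).shift 1, (0 : Fin 2))})
          (fun V : GaugeConfig 2 L Circle => Real.exp (-β * wilsonAction u1Rep V)) U /
        coordAvg (haarProbability Circle)
          (insert (x, (0 : Fin 2))
            (Finset.univ \ {(x, (0 : Fin 2)), (x.shift 1, (0 : Fin 2)), (x, (1 : Fin 2)),
              (x.shift 0, (0 : Fin 2)), ((x.shift 0).shift 0, (1 : Fin 2)), ((x.shift 0).shift 1, (0 : Fin 2))}))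
          (fun V : GaugeConfig 2 L Circle => Real.exp (-β * wilsonAction u1Rep V)) U ≠
      coordAvg (haarProbability Circle)
          (Finset.univ \ {(x, (0 : Fin 2)), (x.shift 1, (0 : Fin 2)), (x, (1 : Fin 2)),
            (x.shift 0, (0 : Fin 2)), ((x.shift 0).shift 0, (1 : Fin 2)), ((x.shift 0).shift 1, (0 : Fin 2))})
          (fun V : GaugeConfig 2 L Circle => Real.exp (-β * wilsonAction u1Rep V)) U' /
        coordAvg (haarProbability Circle)
          (insert (x, (0 : Fin 2))
            (Finset.univ \ {(x, (0 : Fin 2)), (x.shift 1, (0 : Fin 2)), (x, (1 : Fin 2)),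
              (x.shift 0, (0 : Fin 2)), ((x.shift 0).shift 0, (1 : Fin 2)), ((x.shift 0).shift 1, (0 : Fin 2))}))
          (fun V : GaugeConfig 2 L Circle => Real.exp (-β * wilsonAction u1Rep V)) U' := by
  classical
  -- names
  set μ := haarProbability Circle with hμ
  set e₁ : Edge 2 L := (x, (0 : Fin 2)) with he₁
  set e₃ : Edge 2 L := (x.shift 1, (0 : Fin 2)) with he₃
  set e₄ : Edge 2 L := (x, (1 : Fin 2)) with he₄
  set f₁ : Edge 2 L := (x.shift 0, (0 : Fin 2)) with hf₁
  set f₂ : Edge 2 L := ((x.shift 0).shift 0, (1 : Fin 2)) with hf₂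
  set f₃ : Edge 2 L := ((x.shift 0).shift 1, (0 : Fin 2)) with hf₃
  set s : Finset (Edge 2 L) := Finset.univ \ {e₁, e₃, e₄, f₁, f₂, f₃} with hs
  set F : GaugeConfig 2 L Circle → ℝ := fun V => Real.exp (-β * wilsonAction u1Rep V) with hF
  set N := coordAvg μ s F with hN
  set M := coordAvg μ (insert e₁ s) F with hM
  by_contra hcon
  push Not at hcon
  -- hcon : ∀ U U', (agree off `f₁`) → N U / M U = N U' / M U'
  -- geometry
  have h01 : (0 : Fin 2) ≠ 1 := by decide
  have hxy : x ≠ x.shift 0 := (site_shift_ne hL x 0).symm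
  have hx10 : x.shift 1 ≠ x.shift 0 := shift_one_ne_shift_zero hL x
  have hy0 : (x.shift 0).shift 0 ≠ x.shift 0 := site_shift_ne hL (x.shift 0) 0
  have h10 : ∀ {a b : Site 2 L}, ((a, (1 : Fin 2)) : Edge 2 L) ≠ (b, 0) := fun h =>
    h01 (congrArg Prod.snd h).symm
  have hmem_s : ∀ e : Edge 2 L, e ∈ s ↔ e ≠ e₁ ∧ e ≠ e₃ ∧ e ≠ e₄ ∧ e ≠ f₁ ∧ e ≠ f₂ ∧ e ≠ f₃ := by
    intro e; simp [hs]
  -- weight facts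
  obtain ⟨hFm, hFb, hFlo⟩ := wilsonWeight_two_u1_props (L := L) β hβ.le
  have hFgi : IsGaugeInvariant F := isGaugeInvariant_wilsonWeightFun u1Rep β
  have hF1 : ∀ V, F V ≤ 1 := fun V => (le_abs_self _).trans (hFb V)
  have hMb : ∀ U, Real.exp (-(2 * β * (L : ℝ) ^ 2)) ≤ M U ∧ M U ≤ 1 := fun U =>
    coordAvg_mem_Icc μ (insert e₁ s) hFm hFlo hF1 U
  have hMpos : ∀ U, 0 < M U := fun U => lt_of_lt_of_le (Real.exp_pos _) (hMb U).1
  have hMe₁ : ∀ (U : GaugeConfig 2 L Circle) (v : Circle), M (update U e₁ v) = M U := by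
    intro U v
    refine coordAvg_congr_off (insert e₁ s) F fun e he => ?_
    have : e ≠ e₁ := fun h => he (h ▸ Finset.mem_insert_self e₁ s)
    exact update_of_ne this _ _
  -- Step 1: the corner `x + e₀`: its links outside `s` are exactly `e₁` (incoming) and `f₁` (outgoing)
  have hstar : ∀ e : Edge 2 L, e.1 = x.shift 0 ∨ e.1.shift e.2 = x.shift 0 → e ≠ e₁ → e ≠ f₁ → e ∈ s := by
    rintro ⟨z, k⟩ he hne1 hnf1
    rw [hmem_s]
    obtain rfl | rfl : k = 0 ∨ k = 1 := by fin_cases k <;> simp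
    · rcases he with h | h
      · exact (hnf1 (Prod.ext h rfl)).elim
      · exact (hne1 (Prod.ext (site_shift_injective (L := L) 0 h) rfl)).elim
    · rcases he with h | h
      · simp only at h
        subst h
        exact ⟨h10, h10, fun h => hxy (congrArg Prod.fst h).symm, h10,
          fun h => hy0 (congrArg Prod.fst h).symm, h10⟩
      · simp only at h
        refine ⟨h10, h10, fun h' => ?_, h10, fun h' => ?_, h10⟩
        · have hz : z = x := congrArg Prod.fst h'
          subst hz
          exact hx10 h
        · have hz : z = (x.shift 0).shift 0 := congrArg Prod.fst h'
          subst hz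
          exact shift_zero_shift_one_ne hL (x.shift 0) h
  have hne1f : e₁ ≠ f₁ := fun h => hxy (congrArg Prod.fst h)
  have hmoveN : ∀ (U : GaugeConfig 2 L Circle) (g : Circle),
      N (update (update U e₁ (U e₁ * g⁻¹)) f₁ (g * U f₁)) = N U := fun U g =>
    coordAvg_pathHolonomy (s := s) hFgi (y := x.shift 0) (ℓ₁ := e₁) (ℓ₂ := f₁) hne1f rfl hxy rfl hy0
      hstar U g
  -- for `M`, `f₁` is buried at `x + e₀` (its other links `e₁`, `ℓ`, `(x+e₀−e₁, 1)` are integrated)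
  have hstarM : ∀ e : Edge 2 L, e.1 = x.shift 0 ∨ e.1.shift e.2 = x.shift 0 → e ≠ f₁ → e ∈ insert e₁ s := by
    intro e he hnf1
    by_cases h1 : e = e₁
    · exact h1 ▸ Finset.mem_insert_self e₁ s
    · exact Finset.mem_insert_of_mem (hstar e he h1 hnf1)
  have hMf₁ : ∀ (U : GaugeConfig 2 L Circle) (v : Circle), M (update U f₁ v) = M U := fun U v =>
    coordAvg_update_of_buried (s := insert e₁ s) hFgi (x := x.shift 0) (ℓ := f₁) (Or.inl rfl) hy0.symm
      hstarM U v
  have hmoveM : ∀ (U : GaugeConfig 2 L Circle) (g : Circle),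
      M (update (update U e₁ (U e₁ * g⁻¹)) f₁ (g * U f₁)) = M U := by
    intro U g; rw [hMf₁, hMe₁]
  -- Step 2: under `hcon` the conditional `N/M` is blind to `e₁`, hence so is `N`
  have hR : ∀ (U : GaugeConfig 2 L Circle) (g : Circle),
      N (update U e₁ (U e₁ * g⁻¹)) / M (update U e₁ (U e₁ * g⁻¹)) = N U / M U := by
    intro U g
    have h1 := hcon (update (update U e₁ (U e₁ * g⁻¹)) f₁ (g * U f₁)) (update U e₁ (U e₁ * g⁻¹))
      (fun e hf1 => update_of_ne hf1 _ _)
    rw [hmoveN, hmoveM] at h1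
    exact h1.symm
  have hNe₁ : ∀ (U : GaugeConfig 2 L Circle) (v : Circle), N (update U e₁ v) = N U := by
    intro U v
    have h := hR U (v⁻¹ * U e₁)
    have hv : U e₁ * (v⁻¹ * U e₁)⁻¹ = v := by rw [mul_inv_rev, inv_inv, mul_inv_cancel_left]
    rw [hv, hMe₁] at h
    exact (div_left_inj' (hMpos U).ne').1 h
  -- Step 3: against the engine
  obtain ⟨U, v, hUv⟩ := wilson2D_u1_dominoMarginal_reads_closingLink hL hβ x
  exact hUv (hNe₁ U v)

/-- **Corollary: the closing link reads the far plaquette.**  A fortiori there are two configurations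
agreeing off the far boundary `{(x+e₀, 0), (x+2e₀, 1), (x+e₀+e₁, 0)}` of the second plaquette — the three
links of the domino boundary that share no plaquette with `e₁` — on which `N/M` differs. [ours] -/
theorem wilson2D_u1_closingLink_reads_farPlaquette (hL : 2 ≤ L) {β : ℝ} (hβ : 0 < β) (x : Site 2 L) :
    ∃ U U' : GaugeConfig 2 L Circle,
      (∀ e : Edge 2 L, e ≠ (x.shift 0, (0 : Fin 2)) → e ≠ ((x.shift 0).shift 0, (1 : Fin 2)) →
        e ≠ ((x.shift 0).shift 1, (0 : Fin 2)) → U e = U' e) ∧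
      coordAvg (haarProbability Circle)
          (Finset.univ \ {(x, (0 : Fin 2)), (x.shift 1, (0 : Fin 2)), (x, (1 : Fin 2)),
            (x.shift 0, (0 : Fin 2)), ((x.shift 0).shift 0, (1 : Fin 2)), ((x.shift 0).shift 1, (0 : Fin 2))})
          (fun V : GaugeConfig 2 L Circle => Real.exp (-β * wilsonAction u1Rep V)) U /
        coordAvg (haarProbability Circle)
          (insert (x, (0 : Fin 2))
            (Finset.univ \ {(x, (0 : Fin 2)), (x.shift 1, (0 : Fin 2)), (x, (1 : Fin 2)),
              (x.shift 0, (0 : Fin 2)), ((x.shift 0).shift 0, (1 : Fin 2)), ((x.shift 0).shift 1, (0 : Fin 2))}))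
          (fun V : GaugeConfig 2 L Circle => Real.exp (-β * wilsonAction u1Rep V)) U ≠
      coordAvg (haarProbability Circle)
          (Finset.univ \ {(x, (0 : Fin 2)), (x.shift 1, (0 : Fin 2)), (x, (1 : Fin 2)),
            (x.shift 0, (0 : Fin 2)), ((x.shift 0).shift 0, (1 : Fin 2)), ((x.shift 0).shift 1, (0 : Fin 2))})
          (fun V : GaugeConfig 2 L Circle => Real.exp (-β * wilsonAction u1Rep V)) U' /
        coordAvg (haarProbability Circle)
          (insert (x, (0 : Fin 2))
            (Finset.univ \ {(x, (0 : Fin 2)), (x.shift 1, (0 : Fin 2)), (x, (1 : Fin 2)),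
              (x.shift 0, (0 : Fin 2)), ((x.shift 0).shift 0, (1 : Fin 2)), ((x.shift 0).shift 1, (0 : Fin 2))}))
          (fun V : GaugeConfig 2 L Circle => Real.exp (-β * wilsonAction u1Rep V)) U' := by
  obtain ⟨U, U', hUU', hne⟩ := wilson2D_u1_closingLink_reads_collinearLink hL hβ x
  exact ⟨U, U', fun e h1 _ _ => hUU' e h1, hne⟩

end Summit.Ventures.LatticeQCDFlow.Theory2.Autoregressive

end
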